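import Summits.QuantumFields.YangMills.Theorems.SwapTwistDeficitPolyakovHolonomy
import Summits.QuantumFields.YangMills.Theorems.FemtoTransferGapSlabRayleigh
import Summits.QuantumFields.YangMills.Theorems.SwapTwistDeficitTwistTraceSpectral
import HarnessLib

/-!
# The sheet trial function: a `[0,1]`-valued physical test function localised near the flat sheet configuration, with swap-disjoint
# support — basics, physicality, supports, and the swap symmetries of its `L²` and transfer pairings

Third module of the FIXED-LATTICE rungs of the trace-door cruxes K2a `ThermalTraceWindow.SubFemtoFirstLevel` (stmt-QuantumFields-28291) and
`SwapTwistDeficit.TwistDeficit` (stmt-QuantumFields-23317) of seat ym-idea-4.  With `g = sheetTrial` (`…SwapTwistDeficitFlatSheetDefs`: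
`g U = rampHi (polDist U) · rampLo (polDist (S U))`, `S = configPerm (swap 0 1)` the spatial axis swap) and every `L ≥ 1`:

* §1 the ramps: values in `[0,1]`, plateaus (`rampHi = 1` on `[7/4, ∞)`, `= 0` on `(−∞, 3/2]`; `rampLo = 1` on `(−∞, 1/4]`, `= 0` on `[1/2, ∞)`),
  continuity;
* §2 `0 ≤ g ≤ 1`, continuity, ★ `isPhys_sheetTrial` (gauge and centre-twist invariance of `polDist`, `IsPhys.comp_configPerm`); support:
  `g U ≠ 0 ⇒ polDist U > 3/2 ∧ polDist (S U) < 1/2`, hence `g · (g ∘ S) = 0` POINTWISE and, for `g U ≠ 0 ≠ g (S V)`, some axis link with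
  `‖U_{ℓ_j} − V_{ℓ_j}‖_F > 1/L`, so `K_β(U,V) ≤ e^{β(2|E| − 1/(2L²))}` (`transferKernel_le_of_supports`); plateau: `g = 1` on the box `A_r(sheetCfg L)`
  whenever `L·r ≤ 1/4`;
* §3 swap symmetries: `⟨g∘S, g∘S⟩ = ⟨g, g⟩`, `⟨g, g∘S⟩ = 0`, `q_β(ψ∘S, φ∘S) = q_β(ψ, φ)` (kernel and measure are `S`-invariant), hence
  `q_β(g∘S, g∘S) = q_β(g, g)` and `q_β(g∘S, g) = q_β(g, g∘S) ≥ 0`.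

HONEST FRAMING: fixed-lattice bookkeeping for BC5 witnesses of DRAFT lines onto a RECORD rung (K2a ⟶ R2ξ″); no RG content; nothing about
infinite volume, the continuum limit or the Clay gap.  No `sorry`, no new axiom, no new definition.
References: [cite: Luscher1983, §2]; [cite: ReedSimonIV1978, Thm. XIII.1]; [cite: SeilerLNP1982, §3].
-/

set_option autoImplicit false

noncomputable section

open MeasureTheory Filter Topology Real
open scoped Matrix ComplexConjugate BigOperators
open Literature.MathematicalPhysics.QuantumFieldTheory
open Literature.MathematicalPhysics.QuantumLattice

namespace Summit.QuantumFields.YangMills.Theorems.FemtoTransferGap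

namespace FlatSheet

variable {L : ℕ}

/-! ## §1 The ramps -/

/-- `0 ≤ rampHi`. [folklore] -/
theorem rampHi_nonneg (t : ℝ) : 0 ≤ rampHi t := le_max_left _ _

/-- `rampHi ≤ 1`. [folklore] -/
theorem rampHi_le_one (t : ℝ) : rampHi t ≤ 1 := max_le zero_le_one (min_le_left _ _)

/-- `rampHi = 0` below `3/2`. [folklore] -/
theorem rampHi_eq_zero {t : ℝ} (h : t ≤ 3 / 2) : rampHi t = 0 := by
  unfold rampHi
  exact max_eq_left ((min_le_right _ _).trans (by linarith))

/-- `rampHi = 1` above `7/4`. [folklore] -/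
theorem rampHi_eq_one {t : ℝ} (h : 7 / 4 ≤ t) : rampHi t = 1 := by
  unfold rampHi
  rw [min_eq_left (by linarith : (1 : ℝ) ≤ 4 * t - 6), max_eq_right zero_le_one]

/-- `rampHi t ≠ 0 ⇒ 3/2 < t`. [folklore] -/
theorem lt_of_rampHi_ne_zero {t : ℝ} (h : rampHi t ≠ 0) : 3 / 2 < t :=
  not_le.1 fun h' => h (rampHi_eq_zero h')

/-- `rampHi` is continuous. [folklore] -/
theorem continuous_rampHi : Continuous rampHi :=
  continuous_const.max (continuous_const.min ((continuous_const.mul continuous_id).sub continuous_const))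

/-- `0 ≤ rampLo`. [folklore] -/
theorem rampLo_nonneg (t : ℝ) : 0 ≤ rampLo t := le_max_left _ _

/-- `rampLo ≤ 1`. [folklore] -/
theorem rampLo_le_one (t : ℝ) : rampLo t ≤ 1 := max_le zero_le_one (min_le_left _ _)

/-- `rampLo = 1` below `1/4`. [folklore] -/
theorem rampLo_eq_one {t : ℝ} (h : t ≤ 1 / 4) : rampLo t = 1 := by
  unfold rampLo
  rw [min_eq_left (by linarith : (1 : ℝ) ≤ 2 - 4 * t), max_eq_right zero_le_one]

/-- `rampLo = 0` above `1/2`. [folklore] -/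
theorem rampLo_eq_zero {t : ℝ} (h : 1 / 2 ≤ t) : rampLo t = 0 := by
  unfold rampLo
  exact max_eq_left ((min_le_right _ _).trans (by linarith))

/-- `rampLo t ≠ 0 ⇒ t < 1/2`. [folklore] -/
theorem lt_of_rampLo_ne_zero {t : ℝ} (h : rampLo t ≠ 0) : t < 1 / 2 :=
  not_le.1 fun h' => h (rampLo_eq_zero h')

/-- `rampLo` is continuous. [folklore] -/
theorem continuous_rampLo : Continuous rampLo :=
  continuous_const.max (continuous_const.min (continuous_const.sub (continuous_const.mul continuous_id)))

/-! ## §2 The trial function: range, physicality, supports -/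

/-- `0 ≤ g`. [folklore] -/
theorem sheetTrial_nonneg (U : GaugeConfig 3 L SU2) : 0 ≤ sheetTrial U := mul_nonneg (rampHi_nonneg _) (rampLo_nonneg _)

/-- `g ≤ 1`. [folklore] -/
theorem sheetTrial_le_one (U : GaugeConfig 3 L SU2) : sheetTrial U ≤ 1 :=
  mul_le_one₀ (rampHi_le_one _) (rampLo_nonneg _) (rampLo_le_one _)

/-- `|g| ≤ 1`. [folklore] -/
theorem abs_sheetTrial_le_one (U : GaugeConfig 3 L SU2) : |sheetTrial U| ≤ 1 := by
  rw [abs_of_nonneg (sheetTrial_nonneg U)]; exact sheetTrial_le_one U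

/-- The axis swap is continuous on configurations (it permutes coordinates). [folklore] -/
theorem continuous_configPerm (σ : Equiv.Perm (Fin 3)) : Continuous (configPerm (G := SU2) (L := L) σ) :=
  continuous_pi fun e => by simp only [configPerm_apply]; exact continuous_apply _

/-- `g` is continuous. [folklore] -/
theorem continuous_sheetTrial : Continuous (sheetTrial (L := L)) :=
  (continuous_rampHi.comp continuous_polDist).mul
    (continuous_rampLo.comp (continuous_polDist.comp (continuous_configPerm _)))

/-- `g` is measurable. [folklore] -/
theorem measurable_sheetTrial [NeZero L] : Measurable (sheetTrial (L := L)) := by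
  haveI := secondCountableTopology_su2
  exact continuous_sheetTrial.measurable

/-- ★ **The sheet trial function is a physical zero-flux test function** (both factors are continuous bounded functions of the gauge- and
twist-invariant `polDist`, the second through the axis swap, `IsPhys.comp_configPerm`). [cite: Luscher1983, §2] -/
theorem isPhys_sheetTrial [NeZero L] : IsPhys (sheetTrial (L := L)) := by
  have h1 : IsPhys (fun U : GaugeConfig 3 L SU2 => rampHi (polDist U)) :=
    isPhys_comp_polDist continuous_rampHi (C := 1) fun t => by
      rw [abs_of_nonneg (rampHi_nonneg t)]; exact rampHi_le_one t
  have h2 : IsPhys (fun U : GaugeConfig 3 L SU2 => rampLo (polDist U)) :=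
    isPhys_comp_polDist continuous_rampLo (C := 1) fun t => by
      rw [abs_of_nonneg (rampLo_nonneg t)]; exact rampLo_le_one t
  have h2S : IsPhys (fun U : GaugeConfig 3 L SU2 => rampLo (polDist (configPerm (Equiv.swap (0 : Fin 3) 1) U))) :=
    h2.comp_configPerm (Equiv.swap (0 : Fin 3) 1)
  have h := h2S.mul_of_invariant h1.measurable (CJ := 1) (fun U => by rw [abs_of_nonneg (rampHi_nonneg _)]; exact rampHi_le_one _)
    h1.gaugeInv h1.zeroFlux
  exact h

/-- Support of the trial function: `g U ≠ 0 ⇒ polDist U > 3/2` and `polDist (S U) < 1/2`. [folklore] -/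
theorem polDist_of_sheetTrial_ne_zero {U : GaugeConfig 3 L SU2} (h : sheetTrial U ≠ 0) :
    3 / 2 < polDist U ∧ polDist (configPerm (Equiv.swap (0 : Fin 3) 1) U) < 1 / 2 :=
  ⟨lt_of_rampHi_ne_zero (left_ne_zero_of_mul h), lt_of_rampLo_ne_zero (right_ne_zero_of_mul h)⟩

/-- **Swap-disjoint support**: `g U · g (S U) = 0` for every `U`. [folklore] -/
theorem sheetTrial_mul_sheetTrial_swap (U : GaugeConfig 3 L SU2) :
    sheetTrial U * sheetTrial (configPerm (Equiv.swap (0 : Fin 3) 1) U) = 0 := by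
  by_cases h : sheetTrial U = 0
  · rw [h, zero_mul]
  · have hlt := (polDist_of_sheetTrial_ne_zero h).2
    have h2 : sheetTrial (configPerm (Equiv.swap (0 : Fin 3) 1) U) = 0 := by
      unfold sheetTrial
      rw [rampHi_eq_zero (by linarith), zero_mul]
    rw [h2, mul_zero]

/-- **Plateau**: `g = 1` on the box `A_r(sheetCfg L)` when `L·r ≤ 1/4`. [folklore] -/
theorem sheetTrial_eq_one_of_near_sheet [NeZero L] {U : GaugeConfig 3 L SU2} {r : ℝ} (hLr : (L : ℝ) * r ≤ 1 / 4)
    (hU : ∀ e, frobNorm ((U e : Matrix (Fin 2) (Fin 2) ℂ) - (sheetCfg L e : Matrix (Fin 2) (Fin 2) ℂ)) ≤ r) :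
    sheetTrial U = 1 := by
  have h1 := polDist_ge_of_near_sheet hU
  have h2 := polDist_configPerm_le_of_near_sheet hU
  unfold sheetTrial
  rw [rampHi_eq_one (by linarith), rampLo_eq_one (by linarith), mul_one]

/-- **Separated supports**: if `g U ≠ 0` and `g (S V) ≠ 0` then `polDist U − polDist V > 1`, so some axis link has `‖U_{ℓ_j} − V_{ℓ_j}‖_F > 1/L`.
[folklore] -/
theorem exists_far_lineEdge_of_supports [NeZero L] {U V : GaugeConfig 3 L SU2} (hU : sheetTrial U ≠ 0)
    (hV : sheetTrial (configPerm (Equiv.swap (0 : Fin 3) 1) V) ≠ 0) :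
    ∃ j, j < L ∧ 1 / (L : ℝ) < frobNorm ((U (lineEdge L j) : Matrix (Fin 2) (Fin 2) ℂ) - (V (lineEdge L j) : Matrix (Fin 2) (Fin 2) ℂ)) := by
  have h1 := (polDist_of_sheetTrial_ne_zero hU).1
  have h2 := (polDist_of_sheetTrial_ne_zero hV).2
  rw [TT.configPerm_swap_swap] at h2
  refine exists_far_lineEdge U V ?_
  have hL : (0 : ℝ) < L := Nat.cast_pos.2 (Nat.pos_of_ne_zero (NeZero.ne L))
  rw [mul_one_div_cancel hL.ne']
  rw [lt_abs]; left; linarith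

/-- Hence the kernel between the supports of `g` and `g ∘ S` is exponentially suppressed: `K_β(U,V) ≤ e^{β(2|E| − 1/(2L²))}` (`β ≥ 0`).
[cite: SeilerLNP1982, §3] -/
theorem transferKernel_le_of_supports [NeZero L] {β : ℝ} (hβ : 0 ≤ β) {U V : GaugeConfig 3 L SU2} (hU : sheetTrial U ≠ 0)
    (hV : sheetTrial (configPerm (Equiv.swap (0 : Fin 3) 1) V) ≠ 0) :
    transferKernel su2Rep β U V ≤ Real.exp (β * (2 * (Fintype.card (Edge 3 L) : ℝ) - (1 / (L : ℝ)) ^ 2 / 2)) := by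
  obtain ⟨j, -, hj⟩ := exists_far_lineEdge_of_supports hU hV
  exact transferKernel_le_of_far_link hβ (lineEdge L j) (by positivity) hj.le

/-! ## §3 Swap symmetries of the pairings -/

/-- `⟨g∘S, g∘S⟩ = ⟨g, g⟩`. [folklore] -/
theorem l2_sheetTrial_swap [NeZero L] :
    l2 (fun U : GaugeConfig 3 L SU2 => sheetTrial (configPerm (Equiv.swap (0 : Fin 3) 1) U))
      (fun U => sheetTrial (configPerm (Equiv.swap (0 : Fin 3) 1) U)) = l2 (sheetTrial (L := L)) sheetTrial :=
  l2_comp_configPerm _ _ _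

/-- `⟨g, g∘S⟩ = 0` (disjoint supports). [folklore] -/
theorem l2_sheetTrial_cross [NeZero L] :
    l2 (sheetTrial (L := L)) (fun U => sheetTrial (configPerm (Equiv.swap (0 : Fin 3) 1) U)) = 0 := by
  unfold l2
  simp only [sheetTrial_mul_sheetTrial_swap, integral_zero]

/-- **The transfer form is swap invariant**: `q_β(ψ∘S, φ∘S) = q_β(ψ, φ)` (kernel invariance `transferKernel_su2Rep_configPerm` and measure
preservation, one variable at a time). [cite: Luscher1983, §2] -/
theorem qform_comp_swap [NeZero L] (β : ℝ) (ψ φ : GaugeConfig 3 L SU2 → ℝ) :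
    qform su2Rep β (fun U => ψ (configPerm (Equiv.swap (0 : Fin 3) 1) U)) (fun U => φ (configPerm (Equiv.swap (0 : Fin 3) 1) U)) =
      qform su2Rep β ψ φ := by
  set S := configPerm (G := SU2) (L := L) (Equiv.swap (0 : Fin 3) 1) with hS
  have hmp := measurePreserving_configPerm' (L := L) (Equiv.swap (0 : Fin 3) 1)
  unfold qform
  have inner : ∀ U : GaugeConfig 3 L SU2,
      ∫ V, ψ (S U) * transferKernel su2Rep β U V * φ (S V) ∂configMeasure SU2 L =
        ∫ V, ψ (S U) * transferKernel su2Rep β (S U) V * φ V ∂configMeasure SU2 L := by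
    intro U
    have h := hmp.integral_comp' (f := S) (fun V => ψ (S U) * transferKernel su2Rep β (S U) V * φ V)
    rw [← h]
    refine integral_congr_ae (ae_of_all _ fun V => ?_)
    simp only [hS, transferKernel_su2Rep_configPerm]
  simp only [inner]
  exact hmp.integral_comp' (f := S) (fun U => ∫ V, ψ U * transferKernel su2Rep β U V * φ V ∂configMeasure SU2 L)

/-- `q_β(g∘S, g∘S) = q_β(g, g)`. [folklore] -/
theorem qform_sheetTrial_swap_swap [NeZero L] (β : ℝ) :
    qform su2Rep β (fun U : GaugeConfig 3 L SU2 => sheetTrial (configPerm (Equiv.swap (0 : Fin 3) 1) U))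
      (fun U => sheetTrial (configPerm (Equiv.swap (0 : Fin 3) 1) U)) = qform su2Rep β (sheetTrial (L := L)) sheetTrial :=
  qform_comp_swap β _ _

/-- `q_β(g∘S, g) = q_β(g, g∘S)` (`S² = 1`). [folklore] -/
theorem qform_sheetTrial_swap_comm [NeZero L] (β : ℝ) :
    qform su2Rep β (fun U : GaugeConfig 3 L SU2 => sheetTrial (configPerm (Equiv.swap (0 : Fin 3) 1) U)) sheetTrial =
      qform su2Rep β (sheetTrial (L := L)) (fun U => sheetTrial (configPerm (Equiv.swap (0 : Fin 3) 1) U)) := by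
  have h := qform_comp_swap (L := L) β sheetTrial (fun U => sheetTrial (configPerm (Equiv.swap (0 : Fin 3) 1) U))
  simp only [TT.configPerm_swap_swap] at h
  exact h

/-- `0 ≤ q_β(g, g∘S)` (non-negative integrand). [folklore] -/
theorem qform_sheetTrial_cross_nonneg [NeZero L] (β : ℝ) :
    0 ≤ qform su2Rep β (sheetTrial (L := L)) (fun U => sheetTrial (configPerm (Equiv.swap (0 : Fin 3) 1) U)) := by
  unfold qform
  refine integral_nonneg fun U => integral_nonneg fun V => ?_
  have := transferKernel_pos su2Rep β U V
  have := sheetTrial_nonneg U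
  have := sheetTrial_nonneg (configPerm (Equiv.swap (0 : Fin 3) 1) V)
  positivity

end FlatSheet

end Summit.QuantumFields.YangMills.Theorems.FemtoTransferGap

end
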